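import Summits.CriticalPhenomena.PercolationContinuityZ3.Theorems.PercAnnulusCrossingIICPairFormulaMin
import Summits.CriticalPhenomena.PercolationContinuityZ3.Theorems.PercAnnulusCrossingIICFromItsSites
import Summits.CriticalPhenomena.PercolationContinuityZ3.Theorems.PercAnnulusCrossingIICVolumeGivenFar
import Summits.CriticalPhenomena.PercolationContinuityZ3.Theorems.PercNearOneGluingNoHeavyRsw3VolumeSecondMoment
import HarnessLib

/-!
# Around each of its sites the IIC is fat: `ν(#(C(0) ∩ Λ_x(m)) > λ·m^d·π(m) | x ∈ C(0)) ≥ c` (lane RSW3, p1 gen 23)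

builds on p205010 (kernel theorem, internal audit signed; external expert review pending) — USED through `θ(p_c) = 0` (the exact
re-rooting behind `…IICFromItsSites` and `…IICSpanningTree`).

RSW3 lane (LANE 3 `prim-rsw3`), seat `prim-rsw3-p1` (gen 23).  Helper file (`--supports stmt-CriticalPhenomena-4575`); no definitions,
no sorries.  Memo `run/shared/lean/prim/rsw3/P1-QM.md` §36.

Gen 22's `…IICFromItsSites` (SEEN FROM ANY OF ITS SITES THE IIC IS AN IIC: `ν({x} ∪ (x+S) ⊆ C(0)) ≍ π(‖x‖)·ν(S ⊆ C(0))`, constants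
uniform in `S ⊆ Λ(‖x‖/2)`) transfers the first two moments of the IIC ball volume `V_m = #(C(0) ∩ Λ(m))` at the root — `E_ν[V_m] ≍ M·π(m)`
(`…IICVolumeGivenFar`), `E_ν[V_m²] ≤ C·M²·π(m)²` (`…IICPairFormulaMin`), `M = (2m+1)^d` — to the volume `V_x(m) = #(C(0) ∩ Λ_x(m))` around a
far IIC site `x` (`2m ≤ ‖x‖`), on the event `{x ∈ C(0)}` of probability `≍ π(‖x‖)`.  Paley–Zygmund then gives fatness:

* `exists_iicMeasure_sum_box_real_openConn_two_sided_root_criticalProbI` — `c·M·π_{p_c}(m) ≤ E_ν[V_m] ≤ C·M·π_{p_c}(m)` (`m ≥ 1`; gen 22 (K), `S = ∅`);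
* `exists_iicMeasure_sum_box_real_openConn_inter_translate_ge_criticalProbI` — **`E_ν[V_x(m); x ∈ C(0)] ≥ c·π(‖x‖)·M·π(m)`**;
* `exists_iicMeasure_sum_box_sum_box_real_openConn_inter_translate_le_criticalProbI` — **`E_ν[V_x(m)²; x ∈ C(0)] ≤ C·π(‖x‖)·M²·π(m)²`**;
* **`exists_iicMeasure_real_fat_around_site_ge_criticalProbI`** — there are `n₀ ≥ 1`, `0 < λ, c` with
  **`c·π_{p_c}(‖x‖) ≤ ν(x ∈ C(0), V_x(m) > λ·M·π_{p_c}(m))`** and, since `ν(x ∈ C(0)) ≤ C·π(‖x‖)` (`…IICPairFormulaMin`),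
  **`c'·ν(x ∈ C(0)) ≤ ν(x ∈ C(0), V_x(m) > λ·M·π_{p_c}(m))`** (`exists_iicMeasure_real_fat_around_site_ge_mul_criticalProbI`) for every IIC
  probability measure `ν`, `m ≥ 1`, `2m ≤ ‖x‖`, `‖x‖ ≥ n₀`: GIVEN THAT A FAR SITE `x` BELONGS TO THE IIC, WITH CONDITIONAL PROBABILITY `≥ c'`
  THE IIC HAS `≥ λ·m^d·π(m)` SITES WITHIN DISTANCE `m` OF `x` — AROUND EACH OF ITS SITES, AT EVERY SCALE UP TO HALF THE DISTANCE TO THE ROOT,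
  THE IIC IS AS FAT AS AN IIC BALL.  (Companion: `…IICFatWhereItPasses` — the same in every far ball the IIC visits.)
All at `p_c(ℤ^d)`, `d ≥ 2`, under (A2)□(s,L) + `CU⁺_l`; constants uniform in `ν, x, m`.  LANE-4 observable (O23): among arm-conditioned
samples and IIC sites `x` at distance `n`, the histogram of `V_x(m)/(M·π̂(m))`, `m ≤ n/2`.
References: H. Kesten, PTRF 73 (1986) Thm. (8); R. Lyons, Y. Peres, *Probability on Trees and Networks* (2016) §5.5; D. Basu,
A. Sapozhnikov, ECP 22 (2017) Thm. 1.1 and Remark 2.1.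
-/

noncomputable section

namespace Summit.CriticalPhenomena.PercolationContinuityZ3.Theorems.Crossing

open MeasureTheory Filter Topology Literature.Probability.Percolation Literature.Probability.LatticeModels
open Literature.Probability.Percolation.DCT16
open Summit.CriticalPhenomena.PercolationContinuityZ3.Theorems.SurfaceTension

variable {d : ℕ}

/-! ## §1 The first two moments of the volume around a far IIC site -/

open Classical in
/-- **THE MEAN IIC BALL VOLUME `E_ν[V_m] = Σ_{w ∈ Λ(m)} ν(0 ↔ w) ≍ M·π_{p_c}(m)`** (`m ≥ 1`, `M = (2m+1)^d`; `p_c(ℤ^d)`, `d ≥ 2`, (A2)□(s,L) +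
`CU⁺_l`): gen 22's `…IICVolumeGivenFar` with the empty far configuration. [cite: Kesten1986, Thm. (8)] -/
theorem exists_iicMeasure_sum_box_real_openConn_two_sided_root_criticalProbI (hd : 2 ≤ d) {s L : ℕ} (hs : 2 ≤ s) (hsL : s ≤ L)
    {ϰ : ℝ} (hϰ : 0 < ϰ) (hA2 : SetToSetQuasiMultAspectAt d (criticalProbI d) s L ϰ) {l : ℕ} (hl : 2 ≤ l) {cU : ℝ} (hcU : 0 < cU)
    (hCU : ∀ a : ℕ, 1 ≤ a → ∀ E : Set (BondConfig (Site d)), IsUpperSet E → MeasurableSet E →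
      cU * (bondPercolation (zdGraph d) (criticalProbI d)).real E ≤ (bondPercolation (zdGraph d) (criticalProbI d)).real (E ∩
        {ω : BondConfig (Site d) | ∀ t ∈ innerBoundary (zdGraph d) (box d a), ∀ s ∈ innerBoundary (zdGraph d) (box d (l * a)),
          ∀ t' ∈ innerBoundary (zdGraph d) (box d a), ∀ s' ∈ innerBoundary (zdGraph d) (box d (l * a)),
          ω ∈ openConnIn (↑((box d (l * a) \ box d a) ∪ innerBoundary (zdGraph d) (box d a)) : Set (Site d)) t s →
          ω ∈ openConnIn (↑((box d (l * a) \ box d a) ∪ innerBoundary (zdGraph d) (box d a)) : Set (Site d)) t' s' →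
          ω ∈ openConnIn (↑((box d (l * a) \ box d a) ∪ innerBoundary (zdGraph d) (box d a)) : Set (Site d)) s s'})) :
    ∃ c C : ℝ, 0 < c ∧ 0 < C ∧ ∀ (ν : Measure (BondConfig (Site d))) [IsProbabilityMeasure ν],
      (∀ (F : Finset (Sym2 (Site d))) (E : Set (BondConfig (Site d))), MeasurableSet E → DeterminedBy E ↑F →
        Tendsto (fun n : ℕ => (bondPercolation (zdGraph d) (criticalProbI d)).real (E ∩ siteToBoundary d n) /
          oneArmProb d (criticalProbI d) n) atTop (𝓝 (ν.real E))) →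
      ∀ m : ℕ, 1 ≤ m →
        c * ((2 * m + 1 : ℕ) : ℝ) ^ d * oneArmProb d (criticalProbI d) m ≤ ∑ w ∈ box d m, ν.real (openConn (0 : Site d) w) ∧
          ∑ w ∈ box d m, ν.real (openConn (0 : Site d) w) ≤ C * ((2 * m + 1 : ℕ) : ℝ) ^ d * oneArmProb d (criticalProbI d) m := by
  obtain ⟨c, C, hc, hC, hK⟩ := exists_iicMeasure_sum_box_real_openConn_inter_biInter_two_sided_criticalProbI hd hs hsL hϰ hA2 hl hcU hCU
  refine ⟨c, C, hc, hC, fun ν _ hν m hm => ?_⟩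
  have h := hK ν hν m ∅ hm (by simp)
  have he : (⋂ z ∈ (∅ : Finset (Site d)), (openConn (0 : Site d) z : Set (BondConfig (Site d)))) = Set.univ := by
    ext ω; simp
  simp only [he, Set.inter_univ, probReal_univ, mul_one] at h
  exact h

open Classical in
/-- **`E_ν[V_x(m); x ∈ C(0)] = Σ_{w ∈ Λ(m)} ν(0 ↔ x, 0 ↔ x + w) ≥ c·π_{p_c}(‖x‖)·M·π_{p_c}(m)`** (`m ≥ 1`, `2m ≤ ‖x‖`, `‖x‖ ≥ n₀`): the lower
transfer of `…IICFromItsSites` with `S = {w}` and the mean ball volume at the root. [cite: Kesten1986, Thm. (8)]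
[cite: BasuSapozhnikov2017ECP, Thm. 1.1 and Remark 2.1] -/
theorem exists_iicMeasure_sum_box_real_openConn_inter_translate_ge_criticalProbI (hd : 2 ≤ d) {s L : ℕ} (hs : 2 ≤ s) (hsL : s ≤ L)
    {ϰ : ℝ} (hϰ : 0 < ϰ) (hA2 : SetToSetQuasiMultAspectAt d (criticalProbI d) s L ϰ) {l : ℕ} (hl : 2 ≤ l) {cU : ℝ} (hcU : 0 < cU)
    (hCU : ∀ a : ℕ, 1 ≤ a → ∀ E : Set (BondConfig (Site d)), IsUpperSet E → MeasurableSet E →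
      cU * (bondPercolation (zdGraph d) (criticalProbI d)).real E ≤ (bondPercolation (zdGraph d) (criticalProbI d)).real (E ∩
        {ω : BondConfig (Site d) | ∀ t ∈ innerBoundary (zdGraph d) (box d a), ∀ s ∈ innerBoundary (zdGraph d) (box d (l * a)),
          ∀ t' ∈ innerBoundary (zdGraph d) (box d a), ∀ s' ∈ innerBoundary (zdGraph d) (box d (l * a)),
          ω ∈ openConnIn (↑((box d (l * a) \ box d a) ∪ innerBoundary (zdGraph d) (box d a)) : Set (Site d)) t s →
          ω ∈ openConnIn (↑((box d (l * a) \ box d a) ∪ innerBoundary (zdGraph d) (box d a)) : Set (Site d)) t' s' →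
          ω ∈ openConnIn (↑((box d (l * a) \ box d a) ∪ innerBoundary (zdGraph d) (box d a)) : Set (Site d)) s s'})) :
    ∃ (n₀ : ℕ) (c : ℝ), 1 ≤ n₀ ∧ 0 < c ∧ ∀ (ν : Measure (BondConfig (Site d))) [IsProbabilityMeasure ν],
      (∀ (F : Finset (Sym2 (Site d))) (E : Set (BondConfig (Site d))), MeasurableSet E → DeterminedBy E ↑F →
        Tendsto (fun n : ℕ => (bondPercolation (zdGraph d) (criticalProbI d)).real (E ∩ siteToBoundary d n) /
          oneArmProb d (criticalProbI d) n) atTop (𝓝 (ν.real E))) →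
      ∀ (m : ℕ) (x : Site d), 1 ≤ m → 2 * m ≤ Site.supNorm x → n₀ ≤ Site.supNorm x →
        c * oneArmProb d (criticalProbI d) (Site.supNorm x) * ((2 * m + 1 : ℕ) : ℝ) ^ d * oneArmProb d (criticalProbI d) m ≤
          ∑ w ∈ box d m, ν.real ((openConn (0 : Site d) x : Set (BondConfig (Site d))) ∩ openConn (0 : Site d) (x + w)) := by
  obtain ⟨n₀, cF, CF, hn₀, hcF, hCF, hF⟩ :=
    exists_iicMeasure_real_openConn_inter_biInter_translate_two_sided_criticalProbI hd hs hsL hϰ hA2 hl hcU hCU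
  obtain ⟨cK, CK, hcK, hCK, hK⟩ := exists_iicMeasure_sum_box_real_openConn_two_sided_root_criticalProbI hd hs hsL hϰ hA2 hl hcU hCU
  refine ⟨n₀, cF * cK, hn₀, mul_pos hcF hcK, fun ν _ hν m x hm h2m hn₀x => ?_⟩
  obtain ⟨hK1, -⟩ := hK ν hν m hm
  have hstep : ∀ w ∈ box d m, cF * oneArmProb d (criticalProbI d) (Site.supNorm x) * ν.real (openConn (0 : Site d) w) ≤
      ν.real ((openConn (0 : Site d) x : Set (BondConfig (Site d))) ∩ openConn (0 : Site d) (x + w)) := by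
    intro w hw
    have hS : ∀ z ∈ ({w} : Finset (Site d)), 2 * Site.supNorm z ≤ Site.supNorm x := by
      intro z hz; rw [Finset.mem_singleton] at hz; subst hz
      have := mem_box_iff_supNorm_le.1 hw; omega
    have h := (hF ν hν x {w} hn₀x hS).1
    rwa [Finset.set_biInter_singleton, Finset.set_biInter_singleton] at h
  have hπx : 0 ≤ oneArmProb d (criticalProbI d) (Site.supNorm x) := measureReal_nonneg
  calc cF * cK * oneArmProb d (criticalProbI d) (Site.supNorm x) * ((2 * m + 1 : ℕ) : ℝ) ^ d * oneArmProb d (criticalProbI d) m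
      = cF * oneArmProb d (criticalProbI d) (Site.supNorm x) * (cK * ((2 * m + 1 : ℕ) : ℝ) ^ d * oneArmProb d (criticalProbI d) m) := by
        ring
    _ ≤ cF * oneArmProb d (criticalProbI d) (Site.supNorm x) * ∑ w ∈ box d m, ν.real (openConn (0 : Site d) w) :=
        mul_le_mul_of_nonneg_left hK1 (mul_nonneg hcF.le hπx)
    _ = ∑ w ∈ box d m, cF * oneArmProb d (criticalProbI d) (Site.supNorm x) * ν.real (openConn (0 : Site d) w) := by
        rw [Finset.mul_sum]
    _ ≤ _ := Finset.sum_le_sum hstep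

open Classical in
/-- **`E_ν[V_x(m)²; x ∈ C(0)] = Σ_{w, w' ∈ Λ(m)} ν(0 ↔ x, 0 ↔ x + w, 0 ↔ x + w') ≤ C·π_{p_c}(‖x‖)·M²·π_{p_c}(m)²`** (`m ≥ 1`, `2m ≤ ‖x‖`,
`‖x‖ ≥ n₀`): the upper transfer of `…IICFromItsSites` with `S = {w, w'}` and the second moment of the ball volume at the root
(`…IICPairFormulaMin`). [cite: Kesten1986, Thm. (8)] [cite: BasuSapozhnikov2017ECP, Thm. 1.1 and Remark 2.1] -/
theorem exists_iicMeasure_sum_box_sum_box_real_openConn_inter_translate_le_criticalProbI (hd : 2 ≤ d) {s L : ℕ} (hs : 2 ≤ s) (hsL : s ≤ L)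
    {ϰ : ℝ} (hϰ : 0 < ϰ) (hA2 : SetToSetQuasiMultAspectAt d (criticalProbI d) s L ϰ) {l : ℕ} (hl : 2 ≤ l) {cU : ℝ} (hcU : 0 < cU)
    (hCU : ∀ a : ℕ, 1 ≤ a → ∀ E : Set (BondConfig (Site d)), IsUpperSet E → MeasurableSet E →
      cU * (bondPercolation (zdGraph d) (criticalProbI d)).real E ≤ (bondPercolation (zdGraph d) (criticalProbI d)).real (E ∩
        {ω : BondConfig (Site d) | ∀ t ∈ innerBoundary (zdGraph d) (box d a), ∀ s ∈ innerBoundary (zdGraph d) (box d (l * a)),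
          ∀ t' ∈ innerBoundary (zdGraph d) (box d a), ∀ s' ∈ innerBoundary (zdGraph d) (box d (l * a)),
          ω ∈ openConnIn (↑((box d (l * a) \ box d a) ∪ innerBoundary (zdGraph d) (box d a)) : Set (Site d)) t s →
          ω ∈ openConnIn (↑((box d (l * a) \ box d a) ∪ innerBoundary (zdGraph d) (box d a)) : Set (Site d)) t' s' →
          ω ∈ openConnIn (↑((box d (l * a) \ box d a) ∪ innerBoundary (zdGraph d) (box d a)) : Set (Site d)) s s'})) :
    ∃ (n₀ : ℕ) (C : ℝ), 1 ≤ n₀ ∧ 0 < C ∧ ∀ (ν : Measure (BondConfig (Site d))) [IsProbabilityMeasure ν],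
      (∀ (F : Finset (Sym2 (Site d))) (E : Set (BondConfig (Site d))), MeasurableSet E → DeterminedBy E ↑F →
        Tendsto (fun n : ℕ => (bondPercolation (zdGraph d) (criticalProbI d)).real (E ∩ siteToBoundary d n) /
          oneArmProb d (criticalProbI d) n) atTop (𝓝 (ν.real E))) →
      ∀ (m : ℕ) (x : Site d), 1 ≤ m → 2 * m ≤ Site.supNorm x → n₀ ≤ Site.supNorm x →
        ∑ w ∈ box d m, ∑ w' ∈ box d m, ν.real (((openConn (0 : Site d) x : Set (BondConfig (Site d))) ∩ openConn (0 : Site d) (x + w)) ∩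
            ((openConn (0 : Site d) x : Set (BondConfig (Site d))) ∩ openConn (0 : Site d) (x + w'))) ≤
          C * oneArmProb d (criticalProbI d) (Site.supNorm x) * (((2 * m + 1 : ℕ) : ℝ) ^ d) ^ 2 * oneArmProb d (criticalProbI d) m ^ 2 := by
  obtain ⟨n₀, cF, CF, hn₀, hcF, hCF, hF⟩ :=
    exists_iicMeasure_real_openConn_inter_biInter_translate_two_sided_criticalProbI hd hs hsL hϰ hA2 hl hcU hCU
  obtain ⟨C2, hC2, h2⟩ := exists_iicMeasure_sum_box_sum_box_real_openConn_inter_le_criticalProbI hd hs hsL hϰ hA2 hl hcU hCU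
  refine ⟨n₀, CF * C2, hn₀, mul_pos hCF hC2, fun ν _ hν m x hm h2m hn₀x => ?_⟩
  have hSS := h2 ν hν m hm
  have hstep : ∀ w ∈ box d m, ∀ w' ∈ box d m,
      ν.real (((openConn (0 : Site d) x : Set (BondConfig (Site d))) ∩ openConn (0 : Site d) (x + w)) ∩
        ((openConn (0 : Site d) x : Set (BondConfig (Site d))) ∩ openConn (0 : Site d) (x + w'))) ≤
      CF * oneArmProb d (criticalProbI d) (Site.supNorm x) *
        ν.real ((openConn (0 : Site d) w : Set (BondConfig (Site d))) ∩ openConn (0 : Site d) w') := by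
    intro w hw w' hw'
    have hS : ∀ z ∈ ({w, w'} : Finset (Site d)), 2 * Site.supNorm z ≤ Site.supNorm x := by
      intro z hz
      rw [Finset.mem_insert, Finset.mem_singleton] at hz
      rcases hz with rfl | rfl
      · have := mem_box_iff_supNorm_le.1 hw; omega
      · have := mem_box_iff_supNorm_le.1 hw'; omega
    have h := (hF ν hν x {w, w'} hn₀x hS).2
    rw [Finset.set_biInter_insert, Finset.set_biInter_singleton, Finset.set_biInter_insert, Finset.set_biInter_singleton] at h
    have heq : ((openConn (0 : Site d) x : Set (BondConfig (Site d))) ∩ openConn (0 : Site d) (x + w)) ∩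
        ((openConn (0 : Site d) x : Set (BondConfig (Site d))) ∩ openConn (0 : Site d) (x + w')) =
        (openConn (0 : Site d) x : Set (BondConfig (Site d))) ∩
          ((openConn (0 : Site d) (x + w) : Set (BondConfig (Site d))) ∩ openConn (0 : Site d) (x + w')) := by
      ext ω; simp only [Set.mem_inter_iff]; tauto
    rw [heq]
    exact h
  calc ∑ w ∈ box d m, ∑ w' ∈ box d m, ν.real (((openConn (0 : Site d) x : Set (BondConfig (Site d))) ∩ openConn (0 : Site d) (x + w)) ∩
          ((openConn (0 : Site d) x : Set (BondConfig (Site d))) ∩ openConn (0 : Site d) (x + w')))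
      ≤ ∑ w ∈ box d m, ∑ w' ∈ box d m, CF * oneArmProb d (criticalProbI d) (Site.supNorm x) *
          ν.real ((openConn (0 : Site d) w : Set (BondConfig (Site d))) ∩ openConn (0 : Site d) w') :=
        Finset.sum_le_sum fun w hw => Finset.sum_le_sum fun w' hw' => hstep w hw w' hw'
    _ = CF * oneArmProb d (criticalProbI d) (Site.supNorm x) *
          ∑ w ∈ box d m, ∑ w' ∈ box d m, ν.real ((openConn (0 : Site d) w : Set (BondConfig (Site d))) ∩ openConn (0 : Site d) w') := by
        rw [Finset.mul_sum]; exact Finset.sum_congr rfl fun w _ => by rw [Finset.mul_sum]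
    _ ≤ CF * oneArmProb d (criticalProbI d) (Site.supNorm x) *
          (C2 * (((2 * m + 1 : ℕ) : ℝ) ^ d) ^ 2 * oneArmProb d (criticalProbI d) m ^ 2) :=
        mul_le_mul_of_nonneg_left hSS (mul_nonneg hCF.le measureReal_nonneg)
    _ = CF * C2 * oneArmProb d (criticalProbI d) (Site.supNorm x) * (((2 * m + 1 : ℕ) : ℝ) ^ d) ^ 2 *
          oneArmProb d (criticalProbI d) m ^ 2 := by ring

/-! ## §2 Paley–Zygmund: around each of its sites the IIC is fat -/

open Classical in
/-- **AROUND EACH OF ITS SITES THE IIC IS FAT** (`p_c(ℤ^d)`, `d ≥ 2`; (A2)□ at aspect `(s,L)`, `2 ≤ s ≤ L`, `ϰ > 0`; `CU⁺_l(c_U)`, `l ≥ 2`,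
`c_U > 0`): there are `n₀ ≥ 1` and `0 < λ, c` such that for every IIC probability measure `ν`, every `m ≥ 1` and every `x` with `2m ≤ ‖x‖_∞`,
`n₀ ≤ ‖x‖_∞`: **`c·π_{p_c}(‖x‖) ≤ ν(#{w ∈ Λ(m) : 0 ↔ x and 0 ↔ x + w} > λ·(2m+1)^d·π_{p_c}(m))`** — with probability comparable to
`ν(x ∈ C(0)) ≍ π(‖x‖)` the site `x` is in the IIC TOGETHER WITH `≥ λ·m^d·π(m)` sites of `Λ_x(m)` (second-moment method on the events
`{0 ↔ x} ∩ {0 ↔ x + w}`, `w ∈ Λ(m)`, whose union is `{0 ↔ x}`: §1 and `Rsw3.sq_sub_le_real_gt_card_mul_sum`). [cite: Kesten1986, Thm. (8)]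
[cite: LyonsPeres2016, §5.5 (Paley–Zygmund inequality)] -/
theorem exists_iicMeasure_real_fat_around_site_ge_criticalProbI (hd : 2 ≤ d) {s L : ℕ} (hs : 2 ≤ s) (hsL : s ≤ L)
    {ϰ : ℝ} (hϰ : 0 < ϰ) (hA2 : SetToSetQuasiMultAspectAt d (criticalProbI d) s L ϰ) {l : ℕ} (hl : 2 ≤ l) {cU : ℝ} (hcU : 0 < cU)
    (hCU : ∀ a : ℕ, 1 ≤ a → ∀ E : Set (BondConfig (Site d)), IsUpperSet E → MeasurableSet E →
      cU * (bondPercolation (zdGraph d) (criticalProbI d)).real E ≤ (bondPercolation (zdGraph d) (criticalProbI d)).real (E ∩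
        {ω : BondConfig (Site d) | ∀ t ∈ innerBoundary (zdGraph d) (box d a), ∀ s ∈ innerBoundary (zdGraph d) (box d (l * a)),
          ∀ t' ∈ innerBoundary (zdGraph d) (box d a), ∀ s' ∈ innerBoundary (zdGraph d) (box d (l * a)),
          ω ∈ openConnIn (↑((box d (l * a) \ box d a) ∪ innerBoundary (zdGraph d) (box d a)) : Set (Site d)) t s →
          ω ∈ openConnIn (↑((box d (l * a) \ box d a) ∪ innerBoundary (zdGraph d) (box d a)) : Set (Site d)) t' s' →
          ω ∈ openConnIn (↑((box d (l * a) \ box d a) ∪ innerBoundary (zdGraph d) (box d a)) : Set (Site d)) s s'})) :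
    ∃ (n₀ : ℕ) (lam c : ℝ), 1 ≤ n₀ ∧ 0 < lam ∧ 0 < c ∧ ∀ (ν : Measure (BondConfig (Site d))) [IsProbabilityMeasure ν],
      (∀ (F : Finset (Sym2 (Site d))) (E : Set (BondConfig (Site d))), MeasurableSet E → DeterminedBy E ↑F →
        Tendsto (fun n : ℕ => (bondPercolation (zdGraph d) (criticalProbI d)).real (E ∩ siteToBoundary d n) /
          oneArmProb d (criticalProbI d) n) atTop (𝓝 (ν.real E))) →
      ∀ (m : ℕ) (x : Site d), 1 ≤ m → 2 * m ≤ Site.supNorm x → n₀ ≤ Site.supNorm x →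
        c * oneArmProb d (criticalProbI d) (Site.supNorm x) ≤
          ν.real {ω | lam * ((2 * m + 1 : ℕ) : ℝ) ^ d * oneArmProb d (criticalProbI d) m <
            (((box d m).filter fun w => ω ∈ ((openConn (0 : Site d) x : Set (BondConfig (Site d))) ∩ openConn (0 : Site d) (x + w))).card : ℝ)} := by
  have hd1 : 1 ≤ d := le_trans (by norm_num) hd
  have hp : 0 < ((criticalProbI d : unitInterval) : ℝ) := by
    rw [coe_criticalProbI]; exact criticalProb_zd_pos d hd1
  have hπ : ∀ m : ℕ, 0 < oneArmProb d (criticalProbI d) m := fun m => oneArmProb_pos hd1 _ hp m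
  obtain ⟨C₁, hC₁, h1⟩ := exists_iicMeasure_real_openConn_le_mul_all_criticalProbI hd hs hsL hϰ hA2 hl hcU hCU
  obtain ⟨n₁, ca, hn₁, hca, ha⟩ := exists_iicMeasure_sum_box_real_openConn_inter_translate_ge_criticalProbI hd hs hsL hϰ hA2 hl hcU hCU
  obtain ⟨n₂, Cb, hn₂, hCb, hb⟩ := exists_iicMeasure_sum_box_sum_box_real_openConn_inter_translate_le_criticalProbI hd hs hsL hϰ hA2 hl hcU hCU
  refine ⟨n₁ + n₂, ca / (2 * C₁), ca ^ 2 / (4 * Cb), by omega, by positivity, by positivity, fun ν _ hν m x hm h2m hnx => ?_⟩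
  have hx0 : x ≠ 0 := by
    intro h; rw [h, Site.supNorm_eq_zero_iff.2 rfl] at hnx; omega
  have hπm := hπ m
  have hπn := hπ (Site.supNorm x)
  have hU1 := h1 ν hν x hx0
  have hA1 := ha ν hν m x hm h2m (by omega)
  have hB1 := hb ν hν m x hm h2m (by omega)
  -- name the real quantities
  set M : ℝ := ((2 * m + 1 : ℕ) : ℝ) ^ d with hM
  set πm := oneArmProb d (criticalProbI d) m with hπmdef
  set πn := oneArmProb d (criticalProbI d) (Site.supNorm x) with hπndef
  clear_value πm πn
  have hUeq : (⋃ w ∈ box d m, ((openConn (0 : Site d) x : Set (BondConfig (Site d))) ∩ openConn (0 : Site d) (x + w))) = (openConn (0 : Site d) x : Set (BondConfig (Site d))) := by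
    apply Set.Subset.antisymm
    · exact Set.iUnion₂_subset fun w _ => Set.inter_subset_left
    · intro ω hω
      exact Set.mem_iUnion₂.2 ⟨0, zero_mem_box d m, hω, by rw [add_zero]; exact hω⟩
  set H := ν.real (openConn (0 : Site d) x) with hHdef
  set S1 := ∑ w ∈ box d m, ν.real ((openConn (0 : Site d) x : Set (BondConfig (Site d))) ∩ openConn (0 : Site d) (x + w)) with hS1def
  set S2 := ∑ w ∈ box d m, ∑ w' ∈ box d m, ν.real (((openConn (0 : Site d) x : Set (BondConfig (Site d))) ∩ openConn (0 : Site d) (x + w)) ∩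
    ((openConn (0 : Site d) x : Set (BondConfig (Site d))) ∩ openConn (0 : Site d) (x + w'))) with hS2def
  set t : ℝ := ca / (2 * C₁) * M * πm with ht
  set F := ν.real {ω | t < (((box d m).filter fun w => ω ∈ ((openConn (0 : Site d) x : Set (BondConfig (Site d))) ∩ openConn (0 : Site d) (x + w))).card : ℝ)} with hFdef
  have hM0 : 0 < M := by positivity
  have ht0 : 0 ≤ t := by positivity
  have hH0 : 0 ≤ H := measureReal_nonneg
  have hF0 : 0 ≤ F := measureReal_nonneg
  -- `t H ≤ (ca/2) πn M πm ≤ S1/2`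
  have htU : t * H ≤ ca / 2 * πn * M * πm := by
    calc t * H = ca / (2 * C₁) * M * πm * H := by rw [ht]
      _ ≤ ca / (2 * C₁) * M * πm * (C₁ * πn) := mul_le_mul_of_nonneg_left hU1 (by positivity)
      _ = ca / 2 * πn * M * πm := by field_simp
  have hmid : 0 ≤ ca / 2 * πn * M * πm := by positivity
  have hle : t * ν.real (⋃ w ∈ box d m, ((openConn (0 : Site d) x : Set (BondConfig (Site d))) ∩ openConn (0 : Site d) (x + w))) ≤ S1 := by
    rw [hUeq]; linarith
  have hPZ := Rsw3.sq_sub_le_real_gt_card_mul_sum ν (box d m) (fun w => ((openConn (0 : Site d) x : Set (BondConfig (Site d))) ∩ openConn (0 : Site d) (x + w)))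
    (fun w _ => (measurableSet_openConn_holds 0 x).inter (measurableSet_openConn_holds 0 (x + w))) ht0 hle
  rw [hUeq] at hPZ
  have hPZ' : (S1 - t * H) ^ 2 ≤ F * S2 := by
    rw [hS1def, hHdef, hFdef, hS2def]; convert hPZ using 9
  have hgap : ca / 2 * πn * M * πm ≤ S1 - t * H := by linarith
  have hsq : (ca / 2 * πn * M * πm) ^ 2 ≤ F * (Cb * πn * M ^ 2 * πm ^ 2) :=
    (pow_le_pow_left₀ hmid hgap 2).trans (hPZ'.trans (mul_le_mul_of_nonneg_left hB1 hF0))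
  have hpos : 0 < Cb * πn * M ^ 2 * πm ^ 2 := by positivity
  have key : ca ^ 2 / (4 * Cb) * πn * (Cb * πn * M ^ 2 * πm ^ 2) ≤ F * (Cb * πn * M ^ 2 * πm ^ 2) := by
    calc ca ^ 2 / (4 * Cb) * πn * (Cb * πn * M ^ 2 * πm ^ 2) = (ca / 2 * πn * M * πm) ^ 2 := by field_simp; ring
      _ ≤ _ := hsq
  exact le_of_mul_le_mul_right key hpos

open Classical in
/-- **GIVEN THAT A FAR SITE BELONGS TO THE IIC, THE IIC IS FAT AROUND IT** (`p_c(ℤ^d)`, `d ≥ 2`; (A2)□(s,L) + `CU⁺_l`): there are `n₀ ≥ 1`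
and `0 < λ, c` such that for every IIC probability measure `ν`, `m ≥ 1`, `2m ≤ ‖x‖`, `‖x‖ ≥ n₀`, the event
`F = {#{w ∈ Λ(m) : 0 ↔ x and 0 ↔ x + w} > λ·(2m+1)^d·π_{p_c}(m)}` satisfies `F ⊆ {0 ↔ x}` and **`c·ν(0 ↔ x) ≤ ν(F)`**:
conditionally on `x ∈ C(0)`, with probability `≥ c` the IIC has `≥ λ·m^d·π(m)` sites in `Λ_x(m)` (`…_fat_around_site_ge…` and
`ν(0 ↔ x) ≤ C·π(‖x‖)`). [cite: Kesten1986, Thm. (8)] [cite: LyonsPeres2016, §5.5 (Paley–Zygmund inequality)] -/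
theorem exists_iicMeasure_real_fat_around_site_ge_mul_criticalProbI (hd : 2 ≤ d) {s L : ℕ} (hs : 2 ≤ s) (hsL : s ≤ L)
    {ϰ : ℝ} (hϰ : 0 < ϰ) (hA2 : SetToSetQuasiMultAspectAt d (criticalProbI d) s L ϰ) {l : ℕ} (hl : 2 ≤ l) {cU : ℝ} (hcU : 0 < cU)
    (hCU : ∀ a : ℕ, 1 ≤ a → ∀ E : Set (BondConfig (Site d)), IsUpperSet E → MeasurableSet E →
      cU * (bondPercolation (zdGraph d) (criticalProbI d)).real E ≤ (bondPercolation (zdGraph d) (criticalProbI d)).real (E ∩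
        {ω : BondConfig (Site d) | ∀ t ∈ innerBoundary (zdGraph d) (box d a), ∀ s ∈ innerBoundary (zdGraph d) (box d (l * a)),
          ∀ t' ∈ innerBoundary (zdGraph d) (box d a), ∀ s' ∈ innerBoundary (zdGraph d) (box d (l * a)),
          ω ∈ openConnIn (↑((box d (l * a) \ box d a) ∪ innerBoundary (zdGraph d) (box d a)) : Set (Site d)) t s →
          ω ∈ openConnIn (↑((box d (l * a) \ box d a) ∪ innerBoundary (zdGraph d) (box d a)) : Set (Site d)) t' s' →
          ω ∈ openConnIn (↑((box d (l * a) \ box d a) ∪ innerBoundary (zdGraph d) (box d a)) : Set (Site d)) s s'})) :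
    ∃ (n₀ : ℕ) (lam c : ℝ), 1 ≤ n₀ ∧ 0 < lam ∧ 0 < c ∧ ∀ (ν : Measure (BondConfig (Site d))) [IsProbabilityMeasure ν],
      (∀ (F : Finset (Sym2 (Site d))) (E : Set (BondConfig (Site d))), MeasurableSet E → DeterminedBy E ↑F →
        Tendsto (fun n : ℕ => (bondPercolation (zdGraph d) (criticalProbI d)).real (E ∩ siteToBoundary d n) /
          oneArmProb d (criticalProbI d) n) atTop (𝓝 (ν.real E))) →
      ∀ (m : ℕ) (x : Site d), 1 ≤ m → 2 * m ≤ Site.supNorm x → n₀ ≤ Site.supNorm x →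
        {ω | lam * ((2 * m + 1 : ℕ) : ℝ) ^ d * oneArmProb d (criticalProbI d) m <
            (((box d m).filter fun w => ω ∈ ((openConn (0 : Site d) x : Set (BondConfig (Site d))) ∩ openConn (0 : Site d) (x + w))).card : ℝ)} ⊆ (openConn (0 : Site d) x : Set (BondConfig (Site d))) ∧
        c * ν.real (openConn (0 : Site d) x) ≤
          ν.real {ω | lam * ((2 * m + 1 : ℕ) : ℝ) ^ d * oneArmProb d (criticalProbI d) m <
            (((box d m).filter fun w => ω ∈ ((openConn (0 : Site d) x : Set (BondConfig (Site d))) ∩ openConn (0 : Site d) (x + w))).card : ℝ)} := by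
  have hd1 : 1 ≤ d := le_trans (by norm_num) hd
  have hp : 0 < ((criticalProbI d : unitInterval) : ℝ) := by
    rw [coe_criticalProbI]; exact criticalProb_zd_pos d hd1
  have hπ : ∀ m : ℕ, 0 < oneArmProb d (criticalProbI d) m := fun m => oneArmProb_pos hd1 _ hp m
  obtain ⟨C₁, hC₁, h1⟩ := exists_iicMeasure_real_openConn_le_mul_all_criticalProbI hd hs hsL hϰ hA2 hl hcU hCU
  obtain ⟨n₀, lam, c, hn₀, hlam, hc, hF⟩ := exists_iicMeasure_real_fat_around_site_ge_criticalProbI hd hs hsL hϰ hA2 hl hcU hCU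
  refine ⟨n₀, lam, c / C₁, hn₀, hlam, by positivity, fun ν _ hν m x hm h2m hn₀x => ⟨?_, ?_⟩⟩
  · intro ω hω
    rw [Set.mem_setOf_eq] at hω
    have hpos : 0 < ((box d m).filter fun w => ω ∈ ((openConn (0 : Site d) x : Set (BondConfig (Site d))) ∩ openConn (0 : Site d) (x + w))).card := by
      have hπm := hπ m
      have h0 : (0 : ℝ) ≤ lam * ((2 * m + 1 : ℕ) : ℝ) ^ d * oneArmProb d (criticalProbI d) m := by positivity
      exact_mod_cast h0.trans_lt hω
    obtain ⟨w, hw⟩ := Finset.card_pos.1 hpos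
    exact ((Finset.mem_filter.1 hw).2).1
  · have hx0 : x ≠ 0 := by
      intro h; rw [h, Site.supNorm_eq_zero_iff.2 rfl] at hn₀x; omega
    have hU1 := h1 ν hν x hx0
    have h := hF ν hν m x hm h2m hn₀x
    have hπn := hπ (Site.supNorm x)
    set πn := oneArmProb d (criticalProbI d) (Site.supNorm x) with hπndef
    set πm := oneArmProb d (criticalProbI d) m with hπmdef
    clear_value πn πm
    set H := ν.real (openConn (0 : Site d) x) with hHdef
    set F := ν.real {ω | lam * ((2 * m + 1 : ℕ) : ℝ) ^ d * πm <
      (((box d m).filter fun w => ω ∈ ((openConn (0 : Site d) x : Set (BondConfig (Site d))) ∩ openConn (0 : Site d) (x + w))).card : ℝ)} with hFdef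
    -- `hU1 : H ≤ C₁ πn`, `h : c πn ≤ F`; goal `c/C₁ · H ≤ F`
    rw [div_mul_eq_mul_div, div_le_iff₀ hC₁]
    calc c * H ≤ c * (C₁ * πn) := mul_le_mul_of_nonneg_left hU1 hc.le
      _ = C₁ * (c * πn) := by ring
      _ ≤ C₁ * F := mul_le_mul_of_nonneg_left h hC₁.le
      _ = F * C₁ := mul_comm _ _

end Summit.CriticalPhenomena.PercolationContinuityZ3.Theorems.Crossing

end
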